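import Summits.CriticalPhenomena.PercolationContinuityZ3.Theorems.Transplant.CayleySkeletonScaledConn
import Summits.CriticalPhenomena.PercolationContinuityZ3.Theorems.Transplant.CayleyNilpotentFrmFrom
import HarnessLib

/-!
# ONE unit-range chart on SOME generating set makes EVERY Cayley graph of the group a customer of the scaled node: every finitely generated
# nilpotent `NilFrm.Data` group and the free nilpotent groups `N_{m,c}` w.r.t. ARBITRARY finite generating sets (modulo the node and Φ2)

builds on p205010 (kernel theorem, internal audit signed; external expert review pending) — nothing in this file uses p205010.  The percolation
conclusions are CONDITIONAL on the OPEN node `SamePDropOfSkeletonFrmScaled₁` (hypothesis `hN`) and on Φ2 at `p_c` for the scaled cylinders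
(hypothesis `hC`; for kernels of Hirsch length `≥ 2` no Φ2 theorem is typed yet — P4-GENERAL §38.5).  Nothing is claimed about either.
Lane `prim-bschramm`, seat `prim-bschramm-p4` gen 16 (PART C3 of `P4-GENERAL.md` §38: ARBITRARY GENERATING SETS).
Helper file (`--supports stmt-CriticalPhenomena-4575 --as helper`).

THE POINT.  Gen 11–13's `CayleyFrm₃ Γ S₀` / `NilFrm.Data Γ` serve the Cayley graph of the ONE alphabet `S₀` they are built on (unit range, unit steps).
The kernel of the chart does not depend on the alphabet, and `CayleyScaled.ofRank` needs only: the chart, a generating set, two independent images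
anywhere, and a finite kernel generating set.  Hence:
* `CayleyFrm₃.scaledOf C S' hS' : CayleyScaled Γ S'` — for EVERY finite generating `S'` of a group carrying a `CayleyFrm₃` on some `S₀` (kernel
  generators = the short kernel elements of `Cay(Γ; S₀)`, a finite set); `CayleyFrm₃.theta_eq_zero_anyGens_of_frmScaledNode₁`;
* `NilFrm.Data.scaledOf`, **`NilFrm.Data.criticalContinuity_anyGens_of_frmScaledNode₁`** — every finitely generated nilpotent group with a
  `NilFrm.Data` (any class), EVERY finite generating set, modulo the scaled node and Φ2;
* `FreeNilClass.anyGens_theta_eq_zero_of_frmScaledNode₁` — the free nilpotent groups `N_{m+2,c+1}` of every rank and class, EVERY finite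
  generating set (not only the letters), modulo the scaled node and Φ2.
[cite: BenjaminiSchramm1996, Conj. 4; §2 (Cayley graphs)] [cite: KozmaNitzan2024, §1 p. 2 (approach 1); §4 p. 16 (Lemma 8)]
-/

noncomputable section

namespace Summit.CriticalPhenomena.PercolationContinuityZ3.Theorems.Transplant

open SimpleGraph Subgroup Literature.Probability.LatticeModels Literature.Probability.Percolation
open Literature.Barriers.CriticalPhenomena (graphBall graphBall_finite)
open scoped Classical

/-! ## §1 From a `CayleyFrm₃` on one alphabet to `CayleyScaled` on every alphabet -/

namespace CayleyFrm₃

variable {Γ : Type} [Group Γ] {S₀ : Finset Γ} (C : CayleyFrm₃ Γ S₀)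

/-- **The short kernel elements as a finite set** (kernel elements in the ball of radius `r` of `Cay(Γ; S₀)`). [folklore] -/
def kerGens : Finset Γ := (graphBall_finite (mulCayley (S₀ : Set Γ)) (1 : Γ) C.r).toFinset.filter fun k => C.φ k = 0

/-- Membership in `kerGens` is membership in `shortKer`. [folklore] -/
theorem mem_kerGens {k : Γ} : k ∈ C.kerGens ↔ k ∈ CayCyl.shortKer C.φ S₀ C.r := by
  rw [kerGens, Finset.mem_filter, Set.Finite.mem_toFinset]
  exact ⟨fun h => ⟨h.2, h.1⟩, fun h => ⟨h.2, h.1⟩⟩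

/-- **`CayleyScaled` on EVERY finite generating set `S'`** from a `CayleyFrm₃` on some alphabet `S₀`: same chart, rank witnesses = the unit steps
of `S₀`, kernel generators = the short kernel elements. [cite: BenjaminiSchramm1996, §2 (Cayley graphs)] -/
def scaledOf (S' : Finset Γ) (hS' : Subgroup.closure (S' : Set Γ) = ⊤) : CayleyScaled Γ S' :=
  CayleyScaled.ofRank C.φ C.map_mul hS'
    (by
      obtain ⟨s₀, -, h₀⟩ := C.step 0
      obtain ⟨s₁, -, h₁⟩ := C.step 1
      exact ⟨s₀, s₁, by rw [h₀, h₁]; simp [MaxArea.det2]⟩)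
    C.kerGens (fun k hk => (C.mem_kerGens.1 hk).1)
    (fun g hg => Subgroup.closure_mono (fun k hk => Finset.mem_coe.2 (C.mem_kerGens.2 hk)) (C.ker_short g hg))

/-- The chart of `scaledOf` is the chart of the datum. [folklore] -/
@[simp] theorem scaledOf_φ (S' : Finset Γ) (hS' : Subgroup.closure (S' : Set Γ) = ⊤) : (C.scaledOf S' hS').φ = C.φ := rfl

/-- **CONDITIONAL THEOREM (every alphabet): `θ_g(p) = 0` for `p ≤ p_c` on `Cay(Γ; S')` for EVERY finite generating `S'` of a group carrying a
`CayleyFrm₃`**, modulo the scaled node and Φ2 at `p_c` for the scaled cylinders. [cite: BenjaminiSchramm1996, Conj. 4; §2] -/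
theorem theta_eq_zero_anyGens_of_frmScaledNode₁ (hN : SamePDropOfSkeletonFrmScaled₁) (S' : Finset Γ)
    (hS' : Subgroup.closure (S' : Set Γ) = ⊤)
    (hC : (C.scaledOf S' hS').skeletonFrmScaled.CylSubcritical (criticalProbIOf (mulCayley (↑S' : Set Γ)) (1 : Γ))) (g : Γ)
    {p : unitInterval} (hp : (p : ℝ) ≤ criticalProb (mulCayley (↑S' : Set Γ)) g) : theta (mulCayley (↑S' : Set Γ)) g p = 0 :=
  (C.scaledOf S' hS').theta_eq_zero_of_le_of_frmScaledNode₁ hN hC g hp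

end CayleyFrm₃

/-! ## §2 Finitely generated nilpotent groups, every alphabet -/

namespace NilFrm.Data

variable {Γ : Type} [Group Γ] (D : NilFrm.Data Γ)

/-- **`CayleyScaled` on EVERY finite generating set of a `NilFrm.Data` group** (kernel f.g. by the companion alphabet, `K_spec`).
[cite: BenjaminiSchramm1996, §2 (Cayley graphs)] -/
def scaledOf (S' : Finset Γ) (hS' : Subgroup.closure (S' : Set Γ) = ⊤) : CayleyScaled Γ S' :=
  CayleyScaled.ofRank D.φ D.map_mul hS' ⟨D.x, D.y, by rw [D.φ_x, D.φ_y]; simp [MaxArea.det2]⟩ D.K D.K_spec.1 D.K_spec.2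

/-- **CONDITIONAL THEOREM: every finitely generated nilpotent `NilFrm.Data` group, EVERY finite generating set `S'`: `θ_g(p) = 0` for `p ≤ p_c` on
`Cay(Γ; S')`**, modulo the scaled node and Φ2 at `p_c`. [cite: BenjaminiSchramm1996, Conj. 4; §2] [cite: KozmaNitzan2024, §1 p. 2 (approach 1)] -/
theorem theta_eq_zero_anyGens_of_frmScaledNode₁ (hN : SamePDropOfSkeletonFrmScaled₁) (S' : Finset Γ)
    (hS' : Subgroup.closure (S' : Set Γ) = ⊤)
    (hC : (D.scaledOf S' hS').skeletonFrmScaled.CylSubcritical (criticalProbIOf (mulCayley (↑S' : Set Γ)) (1 : Γ))) (g : Γ)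
    {p : unitInterval} (hp : (p : ℝ) ≤ criticalProb (mulCayley (↑S' : Set Γ)) g) : theta (mulCayley (↑S' : Set Γ)) g p = 0 :=
  (D.scaledOf S' hS').theta_eq_zero_of_le_of_frmScaledNode₁ hN hC g hp

/-- **… at `p = p_c`.** [cite: BenjaminiSchramm1996, Conj. 4; §2] -/
theorem criticalContinuity_anyGens_of_frmScaledNode₁ (hN : SamePDropOfSkeletonFrmScaled₁) (S' : Finset Γ)
    (hS' : Subgroup.closure (S' : Set Γ) = ⊤)
    (hC : (D.scaledOf S' hS').skeletonFrmScaled.CylSubcritical (criticalProbIOf (mulCayley (↑S' : Set Γ)) (1 : Γ))) (g : Γ) :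
    theta (mulCayley (↑S' : Set Γ)) g (criticalProbIOf (mulCayley (↑S' : Set Γ)) g) = 0 :=
  (D.scaledOf S' hS').criticalContinuity_of_frmScaledNode₁ hN hC g

end NilFrm.Data

/-! ## §3 The free nilpotent groups of every rank and class, every alphabet -/

namespace FreeNilClass

/-- **CONDITIONAL THEOREM: the free nilpotent group `N_{m+2,c+1}` of EVERY rank and class, EVERY finite generating set `S'` (not only the
letters): `θ_g(p) = 0` for `p ≤ p_c` on `Cay(N_{m+2,c+1}; S')`**, modulo the scaled node and Φ2 at `p_c`.
builds on p205010 (kernel theorem, internal audit signed; external expert review pending). [cite: BenjaminiSchramm1996, Conj. 4; §2] -/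
theorem anyGens_theta_eq_zero_of_frmScaledNode₁ (m c : ℕ) (hN : SamePDropOfSkeletonFrmScaled₁) (S' : Finset (N m c))
    (hS' : Subgroup.closure (S' : Set (N m c)) = ⊤)
    (hC : ((cayleyFrm₃ m c).scaledOf S' hS').skeletonFrmScaled.CylSubcritical (criticalProbIOf (mulCayley (↑S' : Set (N m c))) (1 : N m c)))
    (g : N m c) {p : unitInterval} (hp : (p : ℝ) ≤ criticalProb (mulCayley (↑S' : Set (N m c))) g) :
    theta (mulCayley (↑S' : Set (N m c))) g p = 0 :=
  (cayleyFrm₃ m c).theta_eq_zero_anyGens_of_frmScaledNode₁ hN S' hS' hC g hp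

end FreeNilClass

end Summit.CriticalPhenomena.PercolationContinuityZ3.Theorems.Transplant

end
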